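import Summits.BirchSwinnertonDyer.BirchSwinnertonDyer.Theorems.KolyvaginDepthDoorDepthTableKurihara
import Summits.BirchSwinnertonDyer.BirchSwinnertonDyer.Theorems.KolyvaginDepthDoorDepthTableSteinWuthrichRows6
import Summits.BirchSwinnertonDyer.BirchSwinnertonDyer.Theorems.KolyvaginDepthDoorDepthTableRankTwo446d1TwistBSDQuotientUniform
import Summits.BirchSwinnertonDyer.BirchSwinnertonDyer.Theorems.KolyvaginDepthDoorDepthTableSteinWuthrichRows3
import Summits.BirchSwinnertonDyer.BirchSwinnertonDyer.Theorems.KolyvaginDepthDoorDepthTableRankTwo563a1TwistBSDQuotientUniform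
import Summits.BirchSwinnertonDyer.BirchSwinnertonDyer.Theorems.KolyvaginDepthDoorDepthTableSteinWuthrichRows7
import Summits.BirchSwinnertonDyer.BirchSwinnertonDyer.Theorems.KolyvaginDepthDoorDepthTableRankTwo681c1TwistBSDQuotientUniform
import Summits.BirchSwinnertonDyer.Rank1Residual.Supersingular.CountPointsFast
import Summits.BirchSwinnertonDyer.Rank1Residual.Additive.X4ThreeKuriharaCertKernel
import HarnessLib

/-!
# Route `KolyvaginDepthDoor`, crux `KolyvaginDepthSupplyKN` (stmt-BirchSwinnertonDyer-22820) —
# DEPTH TABLE v17, E-SIDE TABLE (part 3: `446d1`, `563a1`, `681c1`): `Ш(E/ℚ)[p] = 0` at an admissible `p ∈ {7, 11}` from the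
# TREE'S OWN Kurihara records (Kim 2026 Thm. 1.11 by name) — the curves of the table that are anomalous or non-cyclic at `5`

Helper file of the lead prover of line `levelone` (kdd-p1 g21; `--supports stmt-BirchSwinnertonDyer-22820
--as helper`); it closes nothing and BSD is NOT proved by it.

Sequel of `KolyvaginDepthDoorDepthTableKuriharaESideFive1/2`. For the curves below `5` is unusable for Kim's Thm. 1.11 (`a_5 ≡ 1
(mod 5)` — hypothesis (iii) —, or the record's level at `5` has a prime with `25 ∣ #Ẽ(𝔽_ℓ)`), but the tree ALSO holds their
Kurihara records at `p ∈ {7, 11, 13}` (`ν = 2`); at the prime used here every hypothesis is decided in the kernel: `p` good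
ordinary and non-anomalous, `ρ̄_{E,p}` onto (semistable + Mazur's Frobenius no-root witness, Serre Prop. 21), the level
`ℓ₁ℓ₂ ∈ 𝒩₁(E, p)` with cyclic `p`-parts (`countPointsFast`), Kodaira–Néron at `p` (lineage `kodairaNeron_of_five_le`),
`2 ≤ rank_ℤ E(ℚ)` (observatory kernel certificates):

* `446d1` = `[1, -1, 0, -4, 4]` at `p = 7`: record `(7, 71·113 = 8023, 2, 5)` (`RecordsN000431to000464`); `#Ẽ(𝔽_71) = 84`, `#Ẽ(𝔽_113) = 112`; `a_7 = -4`; surjectivity witness `a_5 = -4`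
* `563a1` = `[1, 1, 1, -15, 16]` at `p = 7`: record `(7, 29·281 = 8149, 2, 5)` (`RecordsN000550to000580`); `#Ẽ(𝔽_29) = 28`, `#Ẽ(𝔽_281) = 259`; `a_7 = -5`; surjectivity witness `a_5 = -4`
* `681c1` = `[0, -1, 1, 0, 2]` at `p = 7`: record `(7, 1163·1667 = 1938721, 2, 2)` (`RecordsN000651to000685`); `#Ẽ(𝔽_1163) = 1155`, `#Ẽ(𝔽_1667) = 1652`; `a_7 = -3`; surjectivity witness `a_5 = -4`

RESULT per curve (`C<label>.sha_inf_torsionBy_eq_bot_of_kuriharaClaim_<p>`): `Ш(E/ℚ)[p] = 0` — X1 at `p`, torsion level —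
CONDITIONAL on Kim 2026 Thm. 1.11, modularity, Mazur 1978 Cor. 4.1 BY NAME and the record's CLAIM (`hδ`, read at level `N_E`
through `KuriharaCertificates.Record.Claim`). With the `p = 5` files and the `389a1`/`433a1` row files the `E`-side conjunct of
the depth table is certificate-backed for 17 of the 18 rank-two curves of conductor `≤ 1000` (`664a1`, additive at `2`, would
need Serre Prop. 19 witnesses). Per curve; nothing class-wide; BSD is NOT proved by any of this.

References: [Kim2022StructureSelmer] Thm. 1.11; [Mazur1978] Cor. 4.1, Prop. 6.3 (1); [Serre1972] Prop. 21; [SilvermanAEC2009] VII.3.1.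
-/

set_option linter.dupNamespace false

noncomputable section

open scoped Classical NumberField

namespace Summit.BirchSwinnertonDyer.BirchSwinnertonDyer.Theorems.KolyvaginDepthDoor

open Literature.NumberTheory.EllipticCurves Literature.NumberTheory.EllipticCurves.ModularForms
  WeierstrassCurve NumberField IsDedekindDomain
open Summit.BirchSwinnertonDyer.BirchSwinnertonDyer.Theorems
open Summit.BirchSwinnertonDyer.BirchSwinnertonDyer.Rank2Observatory
open Summit.BirchSwinnertonDyer.BirchSwinnertonDyer.Rank1Residual (IntModel.frobeniusTrace_eq)
open Summit.BirchSwinnertonDyer.Rank1Residual.Supersingular (natCard_point_eq_of_countPoints countPoints_eq_of_fast)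
open Summit.BirchSwinnertonDyer.Rank1Residual.Additive (card_torsion_le_of_intModel_of_card
  isKolyvaginPrime_of_intModel_of_card isKolyvaginProduct_mul)

/-! ## `446d1` = `[1, -1, 0, -4, 4]` at `p = 7`: record `cert_446d1` @ `(7, 71·113)`, `δ̃ ≡ 5` -/

namespace C446d1

/-- `#Ẽ(𝔽_7) = 12` for `446d1` (`a_7 = -4`: good ordinary, non-anomalous at `7`), kernel-decided (`countPointsFast`). [cite: CremonaAlgorithms1997, Table 1 (446d1)] -/
theorem card_7 :
    Nat.card (((⟨1, -1, 0, -4, 4⟩ : WeierstrassCurve ℤ).map (Int.castRingHom (ZMod 7))).toAffine.Point) = 12 :=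
  haveI : Fact (Nat.Prime 7) := ⟨by norm_num⟩
  natCard_point_eq_of_countPoints 1 (-1) 0 (-4) 4 7 (by norm_num) (by decide +kernel) (n := 12)
    (countPoints_eq_of_fast (by decide +kernel))

/-- `#Ẽ(𝔽_71) = 84` for `446d1` (`71 ≡ 1`, `a_71 = -12 ≡ 2 (mod 7)`, `7² ∤ 84`), kernel-decided (`countPointsFast`). [cite: CremonaAlgorithms1997, Table 1 (446d1)] -/
theorem card_71 :
    Nat.card (((⟨1, -1, 0, -4, 4⟩ : WeierstrassCurve ℤ).map (Int.castRingHom (ZMod 71))).toAffine.Point) = 84 :=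
  haveI : Fact (Nat.Prime 71) := ⟨by norm_num⟩
  natCard_point_eq_of_countPoints 1 (-1) 0 (-4) 4 71 (by norm_num) (by decide +kernel) (n := 84)
    (countPoints_eq_of_fast (by decide +kernel))

/-- `#Ẽ(𝔽_113) = 112` for `446d1` (`113 ≡ 1`, `a_113 = 2 ≡ 2 (mod 7)`, `7² ∤ 112`), kernel-decided (`countPointsFast`). [cite: CremonaAlgorithms1997, Table 1 (446d1)] -/
theorem card_113 :
    Nat.card (((⟨1, -1, 0, -4, 4⟩ : WeierstrassCurve ℤ).map (Int.castRingHom (ZMod 113))).toAffine.Point) = 112 :=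
  haveI : Fact (Nat.Prime 113) := ⟨by norm_num⟩
  natCard_point_eq_of_countPoints 1 (-1) 0 (-4) 4 113 (by norm_num) (by decide +kernel) (n := 112)
    (countPoints_eq_of_fast (by decide +kernel))

/-- **`7` is good ordinary for `446d1`** (`7 ∤ Δ`, `a_7 = -4`). [cite: CremonaAlgorithms1997, Table 1 (446d1)] -/
theorem goodOrdinary_7 :
    haveI := Fact.mk (by norm_num : Nat.Prime 7); haveI := isGloballyMinimal_c446d1;
    ((⟨1, -1, 0, -4, 4⟩ : WeierstrassCurve ℤ).map (Int.castRingHom ℚ)).HasGoodReductionAtPrime 7 ∧ ¬ ((7 : ℕ) : ℤ) ∣ ((⟨1, -1, 0, -4, 4⟩ : WeierstrassCurve ℤ).map (Int.castRingHom ℚ)).frobeniusTrace 7 := by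
  haveI := Fact.mk (by norm_num : Nat.Prime 7)
  haveI := isElliptic_c446d1
  haveI := isGloballyMinimal_c446d1
  exact goodOrdinary_of_intModel_certificate intModel 7 (by decide +kernel) (n := 12) card_7 (by decide +kernel)

/-- **`ρ̄_{E,7}` is surjective for `446d1`**: semistable (`gcd(c₄, Δ) = 1`) and `X² − (-4)X + 5` (`a_5 = -4`) has no root
mod `7` (Mazur Prop. 6.3 (1) ⟹ `E[7]` irreducible; Serre Prop. 21 ⟹ onto). [cite: Serre1972, §5.4 Prop. 21] [cite: Mazur1978, §6 Prop. 6.3 (1)] -/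
theorem hasSurjectiveModNGaloisRep_7 :
    haveI := isElliptic_c446d1;
    ((⟨1, -1, 0, -4, 4⟩ : WeierstrassCurve ℤ).map (Int.castRingHom ℚ)).HasSurjectiveModNGaloisRep (7 : ℕ) := by
  have hn : ∀ t : ZMod 7, t ^ 2 - (((5 : ℕ) : ℤ) + 1 - (10 : ℕ) : ℤ) * t + ((5 : ℕ) : ZMod 7) ≠ 0 := by
    decide +kernel
  haveI := Fact.mk (by norm_num : Nat.Prime 7); haveI := Fact.mk (by norm_num : Nat.Prime 5)
  haveI := isElliptic_c446d1; haveI := isGloballyMinimal_c446d1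
  exact hasSurjectiveModNGaloisRep_of_intModel_certificate intModel
    (by rw [Int.isCoprime_iff_gcd_eq_one]; decide +kernel) 7 5 (by norm_num) (by decide +kernel)
    (n := 10) card_5 hn

/-- **`7` is non-anomalous for `446d1`**: `a_7 − 1 = -5`. [cite: SilvermanAEC2009, VII.3 Prop. 3.1] -/
theorem nonAnomalous_7 :
    haveI := isGloballyMinimal_c446d1; haveI := Fact.mk (by norm_num : Nat.Prime 7);
    ¬ ((7 : ℕ) : ℤ) ∣ ((⟨1, -1, 0, -4, 4⟩ : WeierstrassCurve ℤ).map (Int.castRingHom ℚ)).frobeniusTrace 7 - 1 := by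
  haveI := isElliptic_c446d1; haveI := isGloballyMinimal_c446d1; haveI := Fact.mk (by norm_num : Nat.Prime 7)
  rw [IntModel.frobeniusTrace_eq intModel card_7]
  decide

/-- **`8023 = 71·113` is a cyclic Kolyvagin level for `(446d1, 7)`** — the level of the tree record `cert_446d1` at `p = 7`.
[cite: Kim2022StructureSelmer, §1.2.2 (PDF p. 5)] -/
theorem isCyclicKolyvaginLevel_7_8023 :
    haveI := isGloballyMinimal_c446d1; haveI := Fact.mk (by norm_num : Nat.Prime 7);
    IsCyclicKolyvaginLevel ((⟨1, -1, 0, -4, 4⟩ : WeierstrassCurve ℤ).map (Int.castRingHom ℚ)) 7 8023 := by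
  haveI := isElliptic_c446d1
  haveI := isGloballyMinimal_c446d1
  haveI := Fact.mk (by norm_num : Nat.Prime 7)
  haveI : Fact (Nat.Prime 71) := ⟨by norm_num⟩
  haveI : Fact (Nat.Prime 113) := ⟨by norm_num⟩
  have h₁ : Kato.IsKolyvaginPrime ((⟨1, -1, 0, -4, 4⟩ : WeierstrassCurve ℤ).map (Int.castRingHom ℚ)) 7 1 71 :=
    isKolyvaginPrime_of_intModel_of_card intModel 7 1 71 (by norm_num) (by decide +kernel) (by decide) card_71
      (by norm_num)
  have h₂ : Kato.IsKolyvaginPrime ((⟨1, -1, 0, -4, 4⟩ : WeierstrassCurve ℤ).map (Int.castRingHom ℚ)) 7 1 113 :=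
    isKolyvaginPrime_of_intModel_of_card intModel 7 1 113 (by norm_num) (by decide +kernel) (by decide) card_113
      (by norm_num)
  refine ⟨by simpa using isKolyvaginProduct_mul h₁ h₂ (by norm_num), fun ℓ hℓ hdvd ↦ ?_⟩
  rw [show (8023 : ℕ) = 71 * 113 from rfl] at hdvd
  rcases (Nat.Prime.dvd_mul hℓ.out).mp hdvd with h | h
  · obtain rfl := (Nat.prime_dvd_prime_iff_eq hℓ.out (by norm_num)).mp h
    exact card_torsion_le_of_intModel_of_card intModel 7 71 card_71 (by norm_num)
  · obtain rfl := (Nat.prime_dvd_prime_iff_eq hℓ.out (by norm_num)).mp h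
    exact card_torsion_le_of_intModel_of_card intModel 7 113 card_113 (by norm_num)

/-- **`Ш(446d1/ℚ)[7] = 0` FROM THE TREE RECORD `cert_446d1` @ `(7, 71·113)`** (Kurihara currency): granted Kim 2026 Thm. 1.11
(`hKim`), modularity (`hnf`), Mazur 1978 Cor. 4.1 (`hMaz`) BY NAME and the record's CLAIM `hδ` (read at level `N_E` through
`KuriharaCertificates.Record.Claim`), `#Sel_7(E/ℚ) ≤ 7² = 7^rank` and so `Ш(E/ℚ)[7] = 0` (`7` good ordinary `goodOrdinary_7`,
`ρ̄_{E,7}` onto `hasSurjectiveModNGaloisRep_7`, `nonAnomalous_7`, Kodaira–Néron `kodairaNeron_of_five_le 7`, `2 ≤ rank` `KernelCerts001.C446d1.two_le_rank`).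
CONDITIONAL on the three named facts and the claim; per curve; BSD is not proved by it.
[cite: Kim2022StructureSelmer, Thm. 1.11 (PDF p. 8)] [cite: Mazur1978, Cor. 4.1] [cite: CremonaAlgorithms1997, Table 1 (446d1)] -/
theorem sha_inf_torsionBy_eq_bot_of_kuriharaClaim_7
    (hKim : Kim2022_card_selmerGroup_le_pow_of_kuriharaNumber_ne_zero)
    (hnf : exists_isNewformOf) (hMaz : mazur_not_dvd_maninConstant_of_odd)
    (hδ : haveI := isElliptic_c446d1; haveI := isGloballyMinimal_c446d1;
      haveI : NeZero (((⟨1, -1, 0, -4, 4⟩ : WeierstrassCurve ℤ).map (Int.castRingHom ℚ)).conductorNorm ℤ) := neZero_conductorNorm_of_isElliptic _;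
      haveI := Fact.mk (by norm_num : Nat.Prime 7);
      ∀ (D : ModularParametrizationData ((⟨1, -1, 0, -4, 4⟩ : WeierstrassCurve ℤ).map (Int.castRingHom ℚ)) (((⟨1, -1, 0, -4, 4⟩ : WeierstrassCurve ℤ).map (Int.castRingHom ℚ)).conductorNorm ℤ)), ¬ ((7 : ℕ) : ℤ) ∣ D.maninConstant →
        (∃ u : ℚ, ‖(u : ℚ_[7])‖ = 1 ∧ ((⟨1, -1, 0, -4, 4⟩ : WeierstrassCurve ℤ).map (Int.castRingHom ℚ)).realPeriodRat = u * plusPeriod D.f) →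
        ∃ ψ : (ℓ : ℕ) → (ZMod ℓ)ˣ →* Multiplicative (ZMod 7),
          (∀ ℓ ∈ (8023 : ℕ).primeFactors, Function.Surjective (ψ ℓ)) ∧ kuriharaNumber D.f 7 8023 ψ ≠ 0) :
    haveI := isElliptic_c446d1; haveI := isGloballyMinimal_c446d1; haveI := Fact.mk (by norm_num : Nat.Prime 7);
    (((⟨1, -1, 0, -4, 4⟩ : WeierstrassCurve ℤ).map (Int.castRingHom ℚ)).sha ⊓ AddSubgroup.torsionBy ((⟨1, -1, 0, -4, 4⟩ : WeierstrassCurve ℤ).map (Int.castRingHom ℚ)).galH1 ((7 : ℕ) : ℤ) : AddSubgroup _) = ⊥ := by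
  haveI := isElliptic_c446d1
  haveI := isGloballyMinimal_c446d1
  haveI iNZ : NeZero (((⟨1, -1, 0, -4, 4⟩ : WeierstrassCurve ℤ).map (Int.castRingHom ℚ)).conductorNorm ℤ) := neZero_conductorNorm_of_isElliptic _
  haveI := Fact.mk (by norm_num : Nat.Prime 7)
  haveI : NeZero (8023 : ℕ) := ⟨by norm_num⟩
  have hν : (8023 : ℕ).primeFactors.card ≤ ((⟨1, -1, 0, -4, 4⟩ : WeierstrassCurve ℤ).map (Int.castRingHom ℚ)).mordellWeilRank := by
    refine le_trans (le_of_eq ?_) KernelCerts001.C446d1.two_le_rank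
    rw [show (8023 : ℕ) = 71 * 113 from rfl, Nat.primeFactors_mul (by norm_num) (by norm_num),
      Nat.Prime.primeFactors (by norm_num), Nat.Prime.primeFactors (by norm_num)]
    decide
  exact sha_inf_torsionBy_eq_bot_of_kuriharaClaim hKim hnf hMaz _ 7 (by norm_num) goodOrdinary_7.1 goodOrdinary_7.2
    hasSurjectiveModNGaloisRep_7 nonAnomalous_7 (kodairaNeron_of_five_le 7 (by norm_num)) 8023 isCyclicKolyvaginLevel_7_8023 hν hδ

end C446d1

/-! ## `563a1` = `[1, 1, 1, -15, 16]` at `p = 7`: record `cert_563a1` @ `(7, 29·281)`, `δ̃ ≡ 5` -/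

namespace C563a1

/-- `#Ẽ(𝔽_29) = 28` for `563a1` (`29 ≡ 1`, `a_29 = 2 ≡ 2 (mod 7)`, `7² ∤ 28`), kernel-decided (`countPointsFast`). [cite: CremonaAlgorithms1997, Table 1 (563a1)] -/
theorem card_29 :
    Nat.card (((⟨1, 1, 1, -15, 16⟩ : WeierstrassCurve ℤ).map (Int.castRingHom (ZMod 29))).toAffine.Point) = 28 :=
  haveI : Fact (Nat.Prime 29) := ⟨by norm_num⟩
  natCard_point_eq_of_countPoints 1 1 1 (-15) 16 29 (by norm_num) (by decide +kernel) (n := 28)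
    (countPoints_eq_of_fast (by decide +kernel))

/-- `#Ẽ(𝔽_281) = 259` for `563a1` (`281 ≡ 1`, `a_281 = 23 ≡ 2 (mod 7)`, `7² ∤ 259`), kernel-decided (`countPointsFast`). [cite: CremonaAlgorithms1997, Table 1 (563a1)] -/
theorem card_281 :
    Nat.card (((⟨1, 1, 1, -15, 16⟩ : WeierstrassCurve ℤ).map (Int.castRingHom (ZMod 281))).toAffine.Point) = 259 :=
  haveI : Fact (Nat.Prime 281) := ⟨by norm_num⟩
  natCard_point_eq_of_countPoints 1 1 1 (-15) 16 281 (by norm_num) (by decide +kernel) (n := 259)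
    (countPoints_eq_of_fast (by decide +kernel))

/-- **`7` is good ordinary for `563a1`** (`7 ∤ Δ`, `a_7 = -5`). [cite: CremonaAlgorithms1997, Table 1 (563a1)] -/
theorem goodOrdinary_7 :
    haveI := Fact.mk (by norm_num : Nat.Prime 7); haveI := isGloballyMinimal_c563a1;
    ((⟨1, 1, 1, -15, 16⟩ : WeierstrassCurve ℤ).map (Int.castRingHom ℚ)).HasGoodReductionAtPrime 7 ∧ ¬ ((7 : ℕ) : ℤ) ∣ ((⟨1, 1, 1, -15, 16⟩ : WeierstrassCurve ℤ).map (Int.castRingHom ℚ)).frobeniusTrace 7 := by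
  haveI := Fact.mk (by norm_num : Nat.Prime 7)
  haveI := isElliptic_c563a1
  haveI := isGloballyMinimal_c563a1
  exact goodOrdinary_of_intModel_certificate intModel 7 (by decide +kernel) (n := 13) card_7 (by decide +kernel)

/-- **`ρ̄_{E,7}` is surjective for `563a1`**: semistable (`gcd(c₄, Δ) = 1`) and `X² − (-4)X + 5` (`a_5 = -4`) has no root
mod `7` (Mazur Prop. 6.3 (1) ⟹ `E[7]` irreducible; Serre Prop. 21 ⟹ onto). [cite: Serre1972, §5.4 Prop. 21] [cite: Mazur1978, §6 Prop. 6.3 (1)] -/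
theorem hasSurjectiveModNGaloisRep_7 :
    haveI := isElliptic_c563a1;
    ((⟨1, 1, 1, -15, 16⟩ : WeierstrassCurve ℤ).map (Int.castRingHom ℚ)).HasSurjectiveModNGaloisRep (7 : ℕ) := by
  have hn : ∀ t : ZMod 7, t ^ 2 - (((5 : ℕ) : ℤ) + 1 - (10 : ℕ) : ℤ) * t + ((5 : ℕ) : ZMod 7) ≠ 0 := by
    decide +kernel
  haveI := Fact.mk (by norm_num : Nat.Prime 7); haveI := Fact.mk (by norm_num : Nat.Prime 5)
  haveI := isElliptic_c563a1; haveI := isGloballyMinimal_c563a1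
  exact hasSurjectiveModNGaloisRep_of_intModel_certificate intModel
    (by rw [Int.isCoprime_iff_gcd_eq_one]; decide +kernel) 7 5 (by norm_num) (by decide +kernel)
    (n := 10) card_5 hn

/-- **`7` is non-anomalous for `563a1`**: `a_7 − 1 = -6`. [cite: SilvermanAEC2009, VII.3 Prop. 3.1] -/
theorem nonAnomalous_7 :
    haveI := isGloballyMinimal_c563a1; haveI := Fact.mk (by norm_num : Nat.Prime 7);
    ¬ ((7 : ℕ) : ℤ) ∣ ((⟨1, 1, 1, -15, 16⟩ : WeierstrassCurve ℤ).map (Int.castRingHom ℚ)).frobeniusTrace 7 - 1 := by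
  haveI := isElliptic_c563a1; haveI := isGloballyMinimal_c563a1; haveI := Fact.mk (by norm_num : Nat.Prime 7)
  rw [IntModel.frobeniusTrace_eq intModel card_7]
  decide

/-- **`8149 = 29·281` is a cyclic Kolyvagin level for `(563a1, 7)`** — the level of the tree record `cert_563a1` at `p = 7`.
[cite: Kim2022StructureSelmer, §1.2.2 (PDF p. 5)] -/
theorem isCyclicKolyvaginLevel_7_8149 :
    haveI := isGloballyMinimal_c563a1; haveI := Fact.mk (by norm_num : Nat.Prime 7);
    IsCyclicKolyvaginLevel ((⟨1, 1, 1, -15, 16⟩ : WeierstrassCurve ℤ).map (Int.castRingHom ℚ)) 7 8149 := by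
  haveI := isElliptic_c563a1
  haveI := isGloballyMinimal_c563a1
  haveI := Fact.mk (by norm_num : Nat.Prime 7)
  haveI : Fact (Nat.Prime 29) := ⟨by norm_num⟩
  haveI : Fact (Nat.Prime 281) := ⟨by norm_num⟩
  have h₁ : Kato.IsKolyvaginPrime ((⟨1, 1, 1, -15, 16⟩ : WeierstrassCurve ℤ).map (Int.castRingHom ℚ)) 7 1 29 :=
    isKolyvaginPrime_of_intModel_of_card intModel 7 1 29 (by norm_num) (by decide +kernel) (by decide) card_29
      (by norm_num)
  have h₂ : Kato.IsKolyvaginPrime ((⟨1, 1, 1, -15, 16⟩ : WeierstrassCurve ℤ).map (Int.castRingHom ℚ)) 7 1 281 :=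
    isKolyvaginPrime_of_intModel_of_card intModel 7 1 281 (by norm_num) (by decide +kernel) (by decide) card_281
      (by norm_num)
  refine ⟨by simpa using isKolyvaginProduct_mul h₁ h₂ (by norm_num), fun ℓ hℓ hdvd ↦ ?_⟩
  rw [show (8149 : ℕ) = 29 * 281 from rfl] at hdvd
  rcases (Nat.Prime.dvd_mul hℓ.out).mp hdvd with h | h
  · obtain rfl := (Nat.prime_dvd_prime_iff_eq hℓ.out (by norm_num)).mp h
    exact card_torsion_le_of_intModel_of_card intModel 7 29 card_29 (by norm_num)
  · obtain rfl := (Nat.prime_dvd_prime_iff_eq hℓ.out (by norm_num)).mp h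
    exact card_torsion_le_of_intModel_of_card intModel 7 281 card_281 (by norm_num)

/-- **`Ш(563a1/ℚ)[7] = 0` FROM THE TREE RECORD `cert_563a1` @ `(7, 29·281)`** (Kurihara currency): granted Kim 2026 Thm. 1.11
(`hKim`), modularity (`hnf`), Mazur 1978 Cor. 4.1 (`hMaz`) BY NAME and the record's CLAIM `hδ` (read at level `N_E` through
`KuriharaCertificates.Record.Claim`), `#Sel_7(E/ℚ) ≤ 7² = 7^rank` and so `Ш(E/ℚ)[7] = 0` (`7` good ordinary `goodOrdinary_7`,
`ρ̄_{E,7}` onto `hasSurjectiveModNGaloisRep_7`, `nonAnomalous_7`, Kodaira–Néron `kodairaNeron_of_five_le 7`, `2 ≤ rank` `KernelCerts001.C563a1.two_le_rank`).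
CONDITIONAL on the three named facts and the claim; per curve; BSD is not proved by it.
[cite: Kim2022StructureSelmer, Thm. 1.11 (PDF p. 8)] [cite: Mazur1978, Cor. 4.1] [cite: CremonaAlgorithms1997, Table 1 (563a1)] -/
theorem sha_inf_torsionBy_eq_bot_of_kuriharaClaim_7
    (hKim : Kim2022_card_selmerGroup_le_pow_of_kuriharaNumber_ne_zero)
    (hnf : exists_isNewformOf) (hMaz : mazur_not_dvd_maninConstant_of_odd)
    (hδ : haveI := isElliptic_c563a1; haveI := isGloballyMinimal_c563a1;
      haveI : NeZero (((⟨1, 1, 1, -15, 16⟩ : WeierstrassCurve ℤ).map (Int.castRingHom ℚ)).conductorNorm ℤ) := neZero_conductorNorm_of_isElliptic _;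
      haveI := Fact.mk (by norm_num : Nat.Prime 7);
      ∀ (D : ModularParametrizationData ((⟨1, 1, 1, -15, 16⟩ : WeierstrassCurve ℤ).map (Int.castRingHom ℚ)) (((⟨1, 1, 1, -15, 16⟩ : WeierstrassCurve ℤ).map (Int.castRingHom ℚ)).conductorNorm ℤ)), ¬ ((7 : ℕ) : ℤ) ∣ D.maninConstant →
        (∃ u : ℚ, ‖(u : ℚ_[7])‖ = 1 ∧ ((⟨1, 1, 1, -15, 16⟩ : WeierstrassCurve ℤ).map (Int.castRingHom ℚ)).realPeriodRat = u * plusPeriod D.f) →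
        ∃ ψ : (ℓ : ℕ) → (ZMod ℓ)ˣ →* Multiplicative (ZMod 7),
          (∀ ℓ ∈ (8149 : ℕ).primeFactors, Function.Surjective (ψ ℓ)) ∧ kuriharaNumber D.f 7 8149 ψ ≠ 0) :
    haveI := isElliptic_c563a1; haveI := isGloballyMinimal_c563a1; haveI := Fact.mk (by norm_num : Nat.Prime 7);
    (((⟨1, 1, 1, -15, 16⟩ : WeierstrassCurve ℤ).map (Int.castRingHom ℚ)).sha ⊓ AddSubgroup.torsionBy ((⟨1, 1, 1, -15, 16⟩ : WeierstrassCurve ℤ).map (Int.castRingHom ℚ)).galH1 ((7 : ℕ) : ℤ) : AddSubgroup _) = ⊥ := by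
  haveI := isElliptic_c563a1
  haveI := isGloballyMinimal_c563a1
  haveI iNZ : NeZero (((⟨1, 1, 1, -15, 16⟩ : WeierstrassCurve ℤ).map (Int.castRingHom ℚ)).conductorNorm ℤ) := neZero_conductorNorm_of_isElliptic _
  haveI := Fact.mk (by norm_num : Nat.Prime 7)
  haveI : NeZero (8149 : ℕ) := ⟨by norm_num⟩
  have hν : (8149 : ℕ).primeFactors.card ≤ ((⟨1, 1, 1, -15, 16⟩ : WeierstrassCurve ℤ).map (Int.castRingHom ℚ)).mordellWeilRank := by
    refine le_trans (le_of_eq ?_) KernelCerts001.C563a1.two_le_rank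
    rw [show (8149 : ℕ) = 29 * 281 from rfl, Nat.primeFactors_mul (by norm_num) (by norm_num),
      Nat.Prime.primeFactors (by norm_num), Nat.Prime.primeFactors (by norm_num)]
    decide
  exact sha_inf_torsionBy_eq_bot_of_kuriharaClaim hKim hnf hMaz _ 7 (by norm_num) goodOrdinary_7.1 goodOrdinary_7.2
    hasSurjectiveModNGaloisRep_7 nonAnomalous_7 (kodairaNeron_of_five_le 7 (by norm_num)) 8149 isCyclicKolyvaginLevel_7_8149 hν hδ

end C563a1

/-! ## `681c1` = `[0, -1, 1, 0, 2]` at `p = 7`: record `cert_681c1` @ `(7, 1163·1667)`, `δ̃ ≡ 2` -/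

namespace C681c1

/-- `#Ẽ(𝔽_7) = 11` for `681c1` (`a_7 = -3`: good ordinary, non-anomalous at `7`), kernel-decided (`countPointsFast`). [cite: CremonaAlgorithms1997, Table 1 (681c1)] -/
theorem card_7 :
    Nat.card (((⟨0, -1, 1, 0, 2⟩ : WeierstrassCurve ℤ).map (Int.castRingHom (ZMod 7))).toAffine.Point) = 11 :=
  haveI : Fact (Nat.Prime 7) := ⟨by norm_num⟩
  natCard_point_eq_of_countPoints 0 (-1) 1 0 2 7 (by norm_num) (by decide +kernel) (n := 11)
    (countPoints_eq_of_fast (by decide +kernel))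

/-- `#Ẽ(𝔽_1163) = 1155` for `681c1` (`1163 ≡ 1`, `a_1163 = 9 ≡ 2 (mod 7)`, `7² ∤ 1155`), kernel-decided (`countPointsFast`). [cite: CremonaAlgorithms1997, Table 1 (681c1)] -/
theorem card_1163 :
    Nat.card (((⟨0, -1, 1, 0, 2⟩ : WeierstrassCurve ℤ).map (Int.castRingHom (ZMod 1163))).toAffine.Point) = 1155 :=
  haveI : Fact (Nat.Prime 1163) := ⟨by norm_num⟩
  natCard_point_eq_of_countPoints 0 (-1) 1 0 2 1163 (by norm_num) (by decide +kernel) (n := 1155)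
    (countPoints_eq_of_fast (by decide +kernel))

/-- `#Ẽ(𝔽_1667) = 1652` for `681c1` (`1667 ≡ 1`, `a_1667 = 16 ≡ 2 (mod 7)`, `7² ∤ 1652`), kernel-decided (`countPointsFast`). [cite: CremonaAlgorithms1997, Table 1 (681c1)] -/
theorem card_1667 :
    Nat.card (((⟨0, -1, 1, 0, 2⟩ : WeierstrassCurve ℤ).map (Int.castRingHom (ZMod 1667))).toAffine.Point) = 1652 :=
  haveI : Fact (Nat.Prime 1667) := ⟨by norm_num⟩
  natCard_point_eq_of_countPoints 0 (-1) 1 0 2 1667 (by norm_num) (by decide +kernel) (n := 1652)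
    (countPoints_eq_of_fast (by decide +kernel))

/-- **`7` is good ordinary for `681c1`** (`7 ∤ Δ`, `a_7 = -3`). [cite: CremonaAlgorithms1997, Table 1 (681c1)] -/
theorem goodOrdinary_7 :
    haveI := Fact.mk (by norm_num : Nat.Prime 7); haveI := isGloballyMinimal_c681c1;
    ((⟨0, -1, 1, 0, 2⟩ : WeierstrassCurve ℤ).map (Int.castRingHom ℚ)).HasGoodReductionAtPrime 7 ∧ ¬ ((7 : ℕ) : ℤ) ∣ ((⟨0, -1, 1, 0, 2⟩ : WeierstrassCurve ℤ).map (Int.castRingHom ℚ)).frobeniusTrace 7 := by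
  haveI := Fact.mk (by norm_num : Nat.Prime 7)
  haveI := isElliptic_c681c1
  haveI := isGloballyMinimal_c681c1
  exact goodOrdinary_of_intModel_certificate intModel 7 (by decide +kernel) (n := 11) card_7 (by decide +kernel)

/-- **`ρ̄_{E,7}` is surjective for `681c1`**: semistable (`gcd(c₄, Δ) = 1`) and `X² − (-4)X + 5` (`a_5 = -4`) has no root
mod `7` (Mazur Prop. 6.3 (1) ⟹ `E[7]` irreducible; Serre Prop. 21 ⟹ onto). [cite: Serre1972, §5.4 Prop. 21] [cite: Mazur1978, §6 Prop. 6.3 (1)] -/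
theorem hasSurjectiveModNGaloisRep_7 :
    haveI := isElliptic_c681c1;
    ((⟨0, -1, 1, 0, 2⟩ : WeierstrassCurve ℤ).map (Int.castRingHom ℚ)).HasSurjectiveModNGaloisRep (7 : ℕ) := by
  have hn : ∀ t : ZMod 7, t ^ 2 - (((5 : ℕ) : ℤ) + 1 - (10 : ℕ) : ℤ) * t + ((5 : ℕ) : ZMod 7) ≠ 0 := by
    decide +kernel
  haveI := Fact.mk (by norm_num : Nat.Prime 7); haveI := Fact.mk (by norm_num : Nat.Prime 5)
  haveI := isElliptic_c681c1; haveI := isGloballyMinimal_c681c1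
  exact hasSurjectiveModNGaloisRep_of_intModel_certificate intModel
    (by rw [Int.isCoprime_iff_gcd_eq_one]; decide +kernel) 7 5 (by norm_num) (by decide +kernel)
    (n := 10) card_5 hn

/-- **`7` is non-anomalous for `681c1`**: `a_7 − 1 = -4`. [cite: SilvermanAEC2009, VII.3 Prop. 3.1] -/
theorem nonAnomalous_7 :
    haveI := isGloballyMinimal_c681c1; haveI := Fact.mk (by norm_num : Nat.Prime 7);
    ¬ ((7 : ℕ) : ℤ) ∣ ((⟨0, -1, 1, 0, 2⟩ : WeierstrassCurve ℤ).map (Int.castRingHom ℚ)).frobeniusTrace 7 - 1 := by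
  haveI := isElliptic_c681c1; haveI := isGloballyMinimal_c681c1; haveI := Fact.mk (by norm_num : Nat.Prime 7)
  rw [IntModel.frobeniusTrace_eq intModel card_7]
  decide

/-- **`1938721 = 1163·1667` is a cyclic Kolyvagin level for `(681c1, 7)`** — the level of the tree record `cert_681c1` at `p = 7`.
[cite: Kim2022StructureSelmer, §1.2.2 (PDF p. 5)] -/
theorem isCyclicKolyvaginLevel_7_1938721 :
    haveI := isGloballyMinimal_c681c1; haveI := Fact.mk (by norm_num : Nat.Prime 7);
    IsCyclicKolyvaginLevel ((⟨0, -1, 1, 0, 2⟩ : WeierstrassCurve ℤ).map (Int.castRingHom ℚ)) 7 1938721 := by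
  haveI := isElliptic_c681c1
  haveI := isGloballyMinimal_c681c1
  haveI := Fact.mk (by norm_num : Nat.Prime 7)
  haveI : Fact (Nat.Prime 1163) := ⟨by norm_num⟩
  haveI : Fact (Nat.Prime 1667) := ⟨by norm_num⟩
  have h₁ : Kato.IsKolyvaginPrime ((⟨0, -1, 1, 0, 2⟩ : WeierstrassCurve ℤ).map (Int.castRingHom ℚ)) 7 1 1163 :=
    isKolyvaginPrime_of_intModel_of_card intModel 7 1 1163 (by norm_num) (by decide +kernel) (by decide) card_1163
      (by norm_num)
  have h₂ : Kato.IsKolyvaginPrime ((⟨0, -1, 1, 0, 2⟩ : WeierstrassCurve ℤ).map (Int.castRingHom ℚ)) 7 1 1667 :=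
    isKolyvaginPrime_of_intModel_of_card intModel 7 1 1667 (by norm_num) (by decide +kernel) (by decide) card_1667
      (by norm_num)
  refine ⟨by simpa using isKolyvaginProduct_mul h₁ h₂ (by norm_num), fun ℓ hℓ hdvd ↦ ?_⟩
  rw [show (1938721 : ℕ) = 1163 * 1667 from rfl] at hdvd
  rcases (Nat.Prime.dvd_mul hℓ.out).mp hdvd with h | h
  · obtain rfl := (Nat.prime_dvd_prime_iff_eq hℓ.out (by norm_num)).mp h
    exact card_torsion_le_of_intModel_of_card intModel 7 1163 card_1163 (by norm_num)
  · obtain rfl := (Nat.prime_dvd_prime_iff_eq hℓ.out (by norm_num)).mp h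
    exact card_torsion_le_of_intModel_of_card intModel 7 1667 card_1667 (by norm_num)

/-- **`Ш(681c1/ℚ)[7] = 0` FROM THE TREE RECORD `cert_681c1` @ `(7, 1163·1667)`** (Kurihara currency): granted Kim 2026 Thm. 1.11
(`hKim`), modularity (`hnf`), Mazur 1978 Cor. 4.1 (`hMaz`) BY NAME and the record's CLAIM `hδ` (read at level `N_E` through
`KuriharaCertificates.Record.Claim`), `#Sel_7(E/ℚ) ≤ 7² = 7^rank` and so `Ш(E/ℚ)[7] = 0` (`7` good ordinary `goodOrdinary_7`,
`ρ̄_{E,7}` onto `hasSurjectiveModNGaloisRep_7`, `nonAnomalous_7`, Kodaira–Néron `kodairaNeron_of_five_le 7`, `2 ≤ rank` `KernelCerts002.C681c1.two_le_rank`).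
CONDITIONAL on the three named facts and the claim; per curve; BSD is not proved by it.
[cite: Kim2022StructureSelmer, Thm. 1.11 (PDF p. 8)] [cite: Mazur1978, Cor. 4.1] [cite: CremonaAlgorithms1997, Table 1 (681c1)] -/
theorem sha_inf_torsionBy_eq_bot_of_kuriharaClaim_7
    (hKim : Kim2022_card_selmerGroup_le_pow_of_kuriharaNumber_ne_zero)
    (hnf : exists_isNewformOf) (hMaz : mazur_not_dvd_maninConstant_of_odd)
    (hδ : haveI := isElliptic_c681c1; haveI := isGloballyMinimal_c681c1;
      haveI : NeZero (((⟨0, -1, 1, 0, 2⟩ : WeierstrassCurve ℤ).map (Int.castRingHom ℚ)).conductorNorm ℤ) := neZero_conductorNorm_of_isElliptic _;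
      haveI := Fact.mk (by norm_num : Nat.Prime 7);
      ∀ (D : ModularParametrizationData ((⟨0, -1, 1, 0, 2⟩ : WeierstrassCurve ℤ).map (Int.castRingHom ℚ)) (((⟨0, -1, 1, 0, 2⟩ : WeierstrassCurve ℤ).map (Int.castRingHom ℚ)).conductorNorm ℤ)), ¬ ((7 : ℕ) : ℤ) ∣ D.maninConstant →
        (∃ u : ℚ, ‖(u : ℚ_[7])‖ = 1 ∧ ((⟨0, -1, 1, 0, 2⟩ : WeierstrassCurve ℤ).map (Int.castRingHom ℚ)).realPeriodRat = u * plusPeriod D.f) →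
        ∃ ψ : (ℓ : ℕ) → (ZMod ℓ)ˣ →* Multiplicative (ZMod 7),
          (∀ ℓ ∈ (1938721 : ℕ).primeFactors, Function.Surjective (ψ ℓ)) ∧ kuriharaNumber D.f 7 1938721 ψ ≠ 0) :
    haveI := isElliptic_c681c1; haveI := isGloballyMinimal_c681c1; haveI := Fact.mk (by norm_num : Nat.Prime 7);
    (((⟨0, -1, 1, 0, 2⟩ : WeierstrassCurve ℤ).map (Int.castRingHom ℚ)).sha ⊓ AddSubgroup.torsionBy ((⟨0, -1, 1, 0, 2⟩ : WeierstrassCurve ℤ).map (Int.castRingHom ℚ)).galH1 ((7 : ℕ) : ℤ) : AddSubgroup _) = ⊥ := by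
  haveI := isElliptic_c681c1
  haveI := isGloballyMinimal_c681c1
  haveI iNZ : NeZero (((⟨0, -1, 1, 0, 2⟩ : WeierstrassCurve ℤ).map (Int.castRingHom ℚ)).conductorNorm ℤ) := neZero_conductorNorm_of_isElliptic _
  haveI := Fact.mk (by norm_num : Nat.Prime 7)
  haveI : NeZero (1938721 : ℕ) := ⟨by norm_num⟩
  have hν : (1938721 : ℕ).primeFactors.card ≤ ((⟨0, -1, 1, 0, 2⟩ : WeierstrassCurve ℤ).map (Int.castRingHom ℚ)).mordellWeilRank := by
    refine le_trans (le_of_eq ?_) KernelCerts002.C681c1.two_le_rank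
    rw [show (1938721 : ℕ) = 1163 * 1667 from rfl, Nat.primeFactors_mul (by norm_num) (by norm_num),
      Nat.Prime.primeFactors (by norm_num), Nat.Prime.primeFactors (by norm_num)]
    decide
  exact sha_inf_torsionBy_eq_bot_of_kuriharaClaim hKim hnf hMaz _ 7 (by norm_num) goodOrdinary_7.1 goodOrdinary_7.2
    hasSurjectiveModNGaloisRep_7 nonAnomalous_7 (kodairaNeron_of_five_le 7 (by norm_num)) 1938721 isCyclicKolyvaginLevel_7_1938721 hν hδ

end C681c1

end Summit.BirchSwinnertonDyer.BirchSwinnertonDyer.Theorems.KolyvaginDepthDoor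

end
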